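import Literature.MathematicalPhysics.QuantumFieldTheory.Balaban1983to89.B9Eq342CombesThomasFormZd

/-!
# `Balaban1983to89.B9Eq346AgmonReadingZd` — [Balaban1985BackgroundPropagators] Thm 3.1 (3.46) p. 398 ∕ (3.42) p. 397, S. AGMON'S POSITIVE-WEIGHT METHOD
# IN THE CURRENCY OF THE `ℤᵈ` JUNCTION CARRIER `L²(Ω₀, ·)` (`suppSub ∕ formE ∕ fnorm ∕ scaleFn`): for an ℝ-linear `T` with a DISPLAYED weighted
# (conjugated) coercivity `c₀·Σ_z m_z|Φ(z)|²_τ ≤ ⟨ωΦ, T(ω⁻¹Φ)⟩_τ`, every solution of `TΦ = Ψ`, `supp Ψ ⊂ B`, `ω = 1` on `B`, obeys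
# `Σ_{z∈A}|Φ(z)|²_τ ≤ ‖Ψ‖²_τ ∕ (c₀² m_A m_B W²)` — print's (3.46a) SHAPE `B₀(Lʲη)(Lʲ′η)e^{−δ₀d(y,y′)}` with `B₀ = 1∕c₀`, NO `|Ω₀|`, NO window

statement-level skeleton of published theorems with citation tags; proofs where landed; nothing here is a claim about the
Yang–Mills mass gap

`[Balaban1985BackgroundPropagators]` ("B9", CMP **99** (1985) 389–434) p. 398: *«Finally, we have the inequalities in L₂-norms ‖hG′(U)λ‖, ‖hζ∇_UG′(U)λ‖(Lʲη), …
≦ B₀(Lʲη)(Lʲ′η)e^{−δ₀d(y,y′)}‖h‖‖λ‖ for supp h ⊂ Δ̃(y), y ∈ Λ_j, supp λ ⊂ Δ̃(y′) (3.46)»*; p. 397 Thm 3.1 *«uniformly in U, Ω_j»*; (3.42) p. 397 (the pointwise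
kernel bound).  Print proves (3.42)–(3.46) by the random walk of Sects. B–C.  The route's device at the `ℤᵈ` junction frame so far was the Schur-window
Combes–Thomas bound `B9Eq342CombesThomasFormZd.fnorm_apply_le_exp_of_coercive` (this seat, g4), whose window `aN(e^{κr} − 1) < c` compares the conjugation
error with the MATRIX ENTRIES (`4d∕η²`) and therefore forces the rate to `0` with the lattice spacing (g4 ■ CLOSE, «THE GAP LEFT»).  S. Agmon's positive-weight
reading [Agmon1982] — used member-uniformly at def-Y's record carrier by dag-n06-w1 g2 (`B9Thm31SiteGpDecayReg335Y.hs_restrict_GpY_parSymY_le`, `B₀ = 16`) — needs NO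
window: it reads a conjugated coercivity `c₀Σ_z m_z|Φ z|² ≤ ⟨ωΦ, T(ω⁻¹Φ)⟩` (whose defect is compared with the FORM, file `B9Eq324ConjugatedFormZd`) twice.  THIS FILE
types the two readings ONCE for the junction carrier (𝔸-valued site functions supported in the finite `Ω₀ = s`, general finite-dimensional C*-fibre with a
faithful Hermitian trace functional `τ`), so that `G′(U₀) = GpZd` (and every other inverse made an object there) receives (3.46a)∕(3.42)-shaped bounds whose
constants are those of the DISPLAYED coercivity — `1∕c₀`, the level masses `m_z`, the weight `ω` — and nothing else.

CITATION HEADER (lean-in-tree rule).  Cell `pub-ymgap` (YM Track A, HUMAN RULING D-0062 ∕ D-0149 width push), DAG node N06 = [B9], width seat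
`pub-ymgap-dag-n06-w2` (g5), CLAIM-1 («Agmon ∕ form-relative edition of the Combes–Thomas road at the ℤᵈ frame», FILE 1).  Inputs BY NAME: `suppSub ∕ formE ∕
formE_apply` (dag-n06-w4 g0), `single ∕ restrictSite` (dag-n06-w4 g2), the engine's `fnorm ∕ fnorm_smul ∕ fnorm_sq ∕ formE_self_eq_sum_sq ∕ abs_formE_le ∕
formE_single_self ∕ scaleFn ∕ restrictSite_single_coe ∕ single_apply_of_ne` (this seat g4).  MECHANISM CREDIT: dag-n06-w1 g2's `B9Thm31SiteGpDecayReg335Y` §2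
(`agmon_arith`, the two readings) at the Y carrier — re-typed here for a different carrier, nothing of theirs restated or imported.

WHAT IS PROVED (kernel, 0 sorry, 0 def; no `instance`, no `notation`).
* §1 bookkeeping for the weights: `re_trace_star_smul_mul`, `re_trace_star_mul_smul` (real scalars pass through `Re τ(a* b)`), `scaleFn_scaleFn`, `scaleFn_one'`,
  `scaleFn_inv_scaleFn` (`ω⁻¹·(ω·Φ) = Φ`, `ω ≠ 0`), `formE_scaleFn_left` (`⟨ω·f, g⟩_τ = Σ_z ω(z)·Re τ(f(z)* g(z))`), `formE_scaleFn_indicator_self`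
  (`⟨1_B f, 1_B f⟩_τ = Σ_{z∈Ω₀∩B}|f(z)|²_τ`), `sum_weight_sq_fnorm_scaleFn` (`Σ m_z|(ωΦ)(z)|² = Σ m_z ω_z²|Φ(z)|²`).
* §2 ★★ `weighted_sq_sum_le_of_conj_coercive` — THE AGMON READING: conjugated coercivity for a weight `ω > 0` with `ω = 1` on `B ⊇ supp Ψ`, `TΦ = Ψ` ⟹
  `c₀·Σ_{z∈Ω₀} m_z ω_z²|Φ(z)|²_τ ≤ ‖1_BΦ‖_τ·‖Ψ‖_τ`.
* §3 ★★ `sq_sum_le_of_coercive` — FIRST READING (`ω ≡ 1`): `c₀Σ_z m_z|Φ z|² ≤ ⟨Φ,TΦ⟩`, `m ≥ m_B > 0` on `B`, `m ≥ 0` on `Ω₀` ⟹ `‖1_BΦ‖²_τ ≤ ‖Ψ‖²_τ∕(c₀m_B)²`;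
  ★★★ `sq_sum_le_of_conj_coercive` — SECOND READING: plus the conjugated coercivity for `ω`, `ω ≥ W > 0` and `m ≥ m_A > 0` on `A` ⟹
  `Σ_{z∈Ω₀∩A}|Φ(z)|²_τ ≤ ‖Ψ‖²_τ ∕ (c₀²·m_A·m_B·W²)` — (3.46a)'s shape with `B₀ = 1∕c₀` (the level masses `m_z = (L^{j(z)}η)⁻²` give `(Lʲη)(Lʲ′η)` after the square root).
* §4 ★★★ `fnorm_apply_le_of_conj_coercive` — THE POINTWISE KERNEL EDITION ((3.42) n = 0 shape): `TΦ = δ_y w`, `y ∈ Ω₀`, `ω(y) = 1`, `0 < m_x`, `0 < m_y` ⟹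
  `|Φ(x)|_τ ≤ |w|_τ ∕ (c₀·√(m_x m_y)·ω(x))`; `fnorm_inv_single_le_of_conj_coercive` (the same for an inverse map `G`, `T(Gh) = h`);
  `conj_coercive_of_defect` (assembly helper: plain coercivity `c₀Σm|Φ|² ≤ ⟨Φ,TΦ⟩` and a conjugation defect `⟨Φ,TΦ⟩ − θc₀Σm|Φ|² ≤ ⟨ωΦ,T(ω⁻¹Φ)⟩` give the
  conjugated coercivity with `(1 − θ)c₀`).

HONEST SCOPE.  [folklore]∕[Agmon1982] finite-dimensional bookkeeping (Cauchy–Schwarz twice); NO estimate of [B9] is proved here — the (conjugated) coercivity is a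
HYPOTHESIS (print: Thm 3.11 ∕ Sect. B; at the frame: dag-n06-w4's lane for the constant, FILE 2 `B9Eq324ConjugatedFormZd` for the conjugation defect of the
genuine `Ω₀Δ′_a(U₀)Ω₀`); the identification of print's weighted distance `d(y,y′)` with an admissible `ω = e^{κρ}` over the cube geometry is NOT made here.  What
the file buys over g4's window: the constants are EXACTLY those displayed (`c₀`, `m`, `ω`) — if they are uniform in the member (`η`, `|Ω₀|`, `U₀`), so is the
bound.  Count-neutral; N05 ∕ N06 NOT discharged; K1⁹ `stmt-QuantumFields-27364` NOT closed; one finite `𝕋⁴` programme at fixed `ε`, Bałaban as printed; R4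
closes only the conditional finite-`𝕋⁴` rung `BalabanLadder.UV` — nothing continuum ∕ ℝ⁴ ∕ OS ∕ mass gap ∕ Clay.  Unit `pub-ymgap-dag-n06-w2` (g5), 2026-08-28.
-/

noncomputable section

open scoped BigOperators

namespace Literature.MathematicalPhysics.QuantumFieldTheory.Balaban1983to89.B9Eq346AgmonReadingZd

open B9Eq321LandauProjectionZd (suppSub formE formE_apply)
open B9Eq324DeltaPrimeAZd (single restrictSite restrictSite_coe)
open B9Eq342CombesThomasFormZd

export B7Prop1Explicit (Site)

variable {d : ℕ} {𝔸 : Type*} [CStarAlgebra 𝔸] {τ : 𝔸 →ₗ[ℂ] ℂ} {s : Finset (Site d)}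

/-! ## §1  Bookkeeping: real scalars through `Re τ(a* b)`, products of weights, pairings of scaled fields -/

section Bookkeeping

variable (τ) in
/-- `Re τ((c•a)* b) = c·Re τ(a* b)` for a real scalar `c`. [folklore] [cite: Balaban1985BackgroundPropagators, p.391 («natural L² scalar products»; bookkeeping)] -/
theorem re_trace_star_smul_mul (c : ℝ) (a b : 𝔸) : (τ (star (c • a) * b)).re = c * (τ (star a * b)).re := by
  rw [star_smul, star_trivial, smul_mul_assoc, ← Complex.coe_smul, map_smul, smul_eq_mul, Complex.re_ofReal_mul]

variable (τ) in
/-- `Re τ(a* (c•b)) = c·Re τ(a* b)` for a real scalar `c`. [folklore] [cite: Balaban1985BackgroundPropagators, p.391 («natural L² scalar products»; bookkeeping)] -/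
theorem re_trace_star_mul_smul (c : ℝ) (a b : 𝔸) : (τ (star a * (c • b))).re = c * (τ (star a * b)).re := by
  rw [mul_smul_comm, ← Complex.coe_smul, map_smul, smul_eq_mul, Complex.re_ofReal_mul]

/-- `ω·(ω′·f) = (ωω′)·f`. [folklore] [cite: Balaban1988RG2Cluster, (2.7) p.13 (the conjugation weights; bookkeeping)] -/
theorem scaleFn_scaleFn (ω ω' : Site d → ℝ) (f : suppSub (𝔸 := 𝔸) s) :
    scaleFn s ω (scaleFn s ω' f) = scaleFn s (fun z => ω z * ω' z) f := by
  apply Subtype.ext; funext z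
  simp only [scaleFn_coe, smul_smul]

/-- `1·f = f`. [folklore] [cite: Balaban1988RG2Cluster, (2.7) p.13 (bookkeeping)] -/
theorem scaleFn_one' (f : suppSub (𝔸 := 𝔸) s) : scaleFn s (fun _ => (1 : ℝ)) f = f := by
  apply Subtype.ext; funext z
  simp only [scaleFn_coe, one_smul]

/-- two weights agreeing pointwise give the same scaled field. [folklore] [cite: Balaban1988RG2Cluster, (2.7) p.13 (bookkeeping)] -/
theorem scaleFn_congr {ω ω' : Site d → ℝ} (h : ∀ z, ω z = ω' z) (f : suppSub (𝔸 := 𝔸) s) : scaleFn s ω f = scaleFn s ω' f := by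
  apply Subtype.ext; funext z
  simp only [scaleFn_coe, h z]

/-- `ω⁻¹·(ω·f) = f` for a nowhere-vanishing weight. [folklore] [cite: Balaban1988RG2Cluster, (2.7) p.13 (`e^{κρ}e^{−κρ} = 1`; bookkeeping)] -/
theorem scaleFn_inv_scaleFn {ω : Site d → ℝ} (hω : ∀ z, ω z ≠ 0) (f : suppSub (𝔸 := 𝔸) s) :
    scaleFn s (fun z => (ω z)⁻¹) (scaleFn s ω f) = f := by
  rw [scaleFn_scaleFn]
  apply Subtype.ext; funext z
  simp only [scaleFn_coe, inv_mul_cancel₀ (hω z), one_smul]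

/-- **THE PAIRING OF A SCALED FIELD**: `⟨ω·f, g⟩_τ = Σ_{z∈Ω₀} ω(z)·Re τ(f(z)* g(z))`. [cite: Balaban1985BackgroundPropagators, (3.21) p.394 (the scalar product; bookkeeping)] -/
theorem formE_scaleFn_left (ω : Site d → ℝ) (f g : suppSub (𝔸 := 𝔸) s) :
    formE τ s (scaleFn s ω f) g = ∑ z ∈ s, ω z * (τ (star ((f : Site d → 𝔸) z) * (g : Site d → 𝔸) z)).re := by
  rw [formE_apply]
  exact Finset.sum_congr rfl fun z _ => by rw [scaleFn_coe, re_trace_star_smul_mul]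

/-- `⟨1_B f, 1_B f⟩_τ = Σ_{z∈Ω₀∩B}|f(z)|²_τ` for the indicator weight of a finite site set `B`.
[cite: Balaban1985BackgroundPropagators, (3.46) p.398 («‖hG′(U)λ‖ … supp h ⊂ Δ̃(y)»: the localised L²-norm; bookkeeping)] -/
theorem formE_scaleFn_indicator_self (hτp : ∀ a : 𝔸, a ≠ 0 → 0 < (τ (star a * a)).re) (B : Finset (Site d)) (f : suppSub (𝔸 := 𝔸) s) :
    formE τ s (scaleFn s (fun z => if z ∈ B then (1 : ℝ) else 0) f) (scaleFn s (fun z => if z ∈ B then (1 : ℝ) else 0) f) =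
      ∑ z ∈ s ∩ B, fnorm τ ((f : Site d → 𝔸) z) ^ 2 := by
  rw [formE_self_eq_sum_sq hτp, ← Finset.sum_ite_mem]
  refine Finset.sum_congr rfl fun z _ => ?_
  rw [scaleFn_coe]
  by_cases hz : z ∈ B
  · simp only [hz, if_true, one_smul]
  · simp only [hz, if_false, zero_smul, fnorm_zero, sq, zero_mul]

/-- `Σ_z m_z|(ω·Φ)(z)|²_τ = Σ_z m_z ω_z²|Φ(z)|²_τ`. [cite: Balaban1985BackgroundPropagators, (3.46) p.398 (bookkeeping)] -/
theorem sum_weight_sq_fnorm_scaleFn (m ω : Site d → ℝ) (f : suppSub (𝔸 := 𝔸) s) :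
    ∑ z ∈ s, m z * fnorm τ ((scaleFn s ω f : Site d → 𝔸) z) ^ 2 = ∑ z ∈ s, m z * ω z ^ 2 * fnorm τ ((f : Site d → 𝔸) z) ^ 2 := by
  refine Finset.sum_congr rfl fun z _ => ?_
  rw [scaleFn_coe, fnorm_smul, mul_pow, sq_abs, mul_assoc]

end Bookkeeping

/-! ## §2  The Agmon reading: conjugated coercivity read at `Φ′ = ωΦ` -/

section Reading

variable {T : suppSub (𝔸 := 𝔸) s →ₗ[ℝ] suppSub (𝔸 := 𝔸) s}

/-- ★★ **THE AGMON READING.**  Let `T` be an ℝ-linear operator of `L²(Ω₀, ·)`, `ω > 0` a site weight and `m` site masses with the CONJUGATED COERCIVITY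
`c₀·Σ_{z∈Ω₀} m_z|Φ(z)|²_τ ≤ ⟨ωΦ, T(ω⁻¹Φ)⟩_τ` for every `Φ`.  If `TΦ = Ψ` with `Ψ` vanishing off the finite site set `B` and `ω = 1` on `B`, then
`c₀·Σ_{z∈Ω₀} m_z ω_z²|Φ(z)|²_τ ≤ ‖1_BΦ‖_τ·‖Ψ‖_τ` (`‖1_BΦ‖²_τ = Σ_{z∈Ω₀∩B}|Φ z|²_τ`).  PROOF: the hypothesis at `Φ′ := ωΦ` reads `c₀Σ m_z|ωΦ|² ≤ ⟨ω²Φ, TΦ⟩ =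
⟨ω²Φ, Ψ⟩ = ⟨1_BΦ, Ψ⟩` (`Ψ = 0` off `B`, `ω = 1` on `B`), and Cauchy–Schwarz.
[cite: Balaban1985BackgroundPropagators, (3.46) p.398, Thm 3.1 p.397; Agmon1982, Thm 1.5 p.19 (the positive-weight identity)] -/
theorem weighted_sq_sum_le_of_conj_coercive (hτp : ∀ a : 𝔸, a ≠ 0 → 0 < (τ (star a * a)).re) (hτs : ∀ a : 𝔸, τ (star a) = starRingEnd ℂ (τ a))
    {c₀ : ℝ} {m ω : Site d → ℝ} (hω : ∀ z, 0 < ω z)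
    (hcc : ∀ Φ : suppSub (𝔸 := 𝔸) s, c₀ * ∑ z ∈ s, m z * fnorm τ ((Φ : Site d → 𝔸) z) ^ 2 ≤
      formE τ s (scaleFn s ω Φ) (T (scaleFn s (fun z => (ω z)⁻¹) Φ)))
    {B : Finset (Site d)} (hωB : ∀ z ∈ B, ω z = 1)
    {Φ Ψ : suppSub (𝔸 := 𝔸) s} (hΨB : ∀ z, z ∉ B → (Ψ : Site d → 𝔸) z = 0) (hTΦ : T Φ = Ψ) :
    c₀ * ∑ z ∈ s, m z * ω z ^ 2 * fnorm τ ((Φ : Site d → 𝔸) z) ^ 2 ≤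
      Real.sqrt (∑ z ∈ s ∩ B, fnorm τ ((Φ : Site d → 𝔸) z) ^ 2) * Real.sqrt (formE τ s Ψ Ψ) := by
  classical
  -- the hypothesis at `Φ′ = ωΦ`
  have h := hcc (scaleFn s ω Φ)
  rw [sum_weight_sq_fnorm_scaleFn, scaleFn_inv_scaleFn (fun z => (hω z).ne') Φ, hTΦ, scaleFn_scaleFn, formE_scaleFn_left] at h
  -- `⟨ω²Φ, Ψ⟩ = ⟨1_BΦ, Ψ⟩`
  set χ : Site d → ℝ := fun z => if z ∈ B then (1 : ℝ) else 0 with hχ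
  have hsum : ∑ z ∈ s, ω z * ω z * (τ (star ((Φ : Site d → 𝔸) z) * (Ψ : Site d → 𝔸) z)).re =
      formE τ s (scaleFn s χ Φ) Ψ := by
    rw [formE_scaleFn_left]
    refine Finset.sum_congr rfl fun z _ => ?_
    by_cases hz : z ∈ B
    · simp only [hχ, hz, if_true, hωB z hz, one_mul]
    · simp only [hχ, hz, if_false, hΨB z hz, mul_zero, map_zero, Complex.zero_re]
  rw [hsum] at h
  -- Cauchy–Schwarz
  have hcs := (le_abs_self _).trans (abs_formE_le hτp hτs (scaleFn s χ Φ) Ψ)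
  rw [formE_scaleFn_indicator_self hτp B Φ] at hcs
  exact h.trans hcs

end Reading

/-! ## §3  The two readings: `ω ≡ 1` on the support block, then a general weight -/

section TwoReadings

variable {T : suppSub (𝔸 := 𝔸) s →ₗ[ℝ] suppSub (𝔸 := 𝔸) s}

/-- ★★ **FIRST READING (`ω ≡ 1`)**: plain weighted coercivity `c₀·Σ_z m_z|Φ(z)|²_τ ≤ ⟨Φ, TΦ⟩_τ` (`c₀ > 0`, `m ≥ 0` on `Ω₀`, `m ≥ m_B > 0` on `B`), `TΦ = Ψ`, `Ψ = 0` off `B`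
⟹ `Σ_{z∈Ω₀∩B}|Φ(z)|²_τ ≤ ‖Ψ‖²_τ ∕ (c₀m_B)²` — the localised norm of the solution ON THE SOURCE BLOCK costs one inverse mass.
[cite: Balaban1985BackgroundPropagators, (3.46) p.398, Thm 3.1 p.397, Thm 3.11 p.416; Agmon1982, Thm 1.5 p.19] -/
theorem sq_sum_le_of_coercive (hτp : ∀ a : 𝔸, a ≠ 0 → 0 < (τ (star a * a)).re) (hτs : ∀ a : 𝔸, τ (star a) = starRingEnd ℂ (τ a))
    {c₀ mB : ℝ} (hc₀ : 0 < c₀) (hmB : 0 < mB) {m : Site d → ℝ} (hm0 : ∀ z ∈ s, 0 ≤ m z)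
    (hco : ∀ Φ : suppSub (𝔸 := 𝔸) s, c₀ * ∑ z ∈ s, m z * fnorm τ ((Φ : Site d → 𝔸) z) ^ 2 ≤ formE τ s Φ (T Φ))
    {B : Finset (Site d)} (hmB' : ∀ z ∈ B, mB ≤ m z)
    {Φ Ψ : suppSub (𝔸 := 𝔸) s} (hΨB : ∀ z, z ∉ B → (Ψ : Site d → 𝔸) z = 0) (hTΦ : T Φ = Ψ) :
    ∑ z ∈ s ∩ B, fnorm τ ((Φ : Site d → 𝔸) z) ^ 2 ≤ formE τ s Ψ Ψ / (c₀ * mB) ^ 2 := by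
  classical
  -- the reading with `ω ≡ 1`
  have hcc : ∀ Φ : suppSub (𝔸 := 𝔸) s, c₀ * ∑ z ∈ s, m z * fnorm τ ((Φ : Site d → 𝔸) z) ^ 2 ≤
      formE τ s (scaleFn s (fun _ => (1 : ℝ)) Φ) (T (scaleFn s (fun z => ((fun _ => (1 : ℝ)) z)⁻¹) Φ)) := by
    intro Φ'
    have h1 : scaleFn s (fun z => ((fun _ => (1 : ℝ)) z)⁻¹) Φ' = Φ' := by
      rw [scaleFn_congr (ω' := fun _ => (1 : ℝ)) (fun z => by simp), scaleFn_one']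
    rw [h1, scaleFn_one']
    exact hco Φ'
  have h := weighted_sq_sum_le_of_conj_coercive hτp hτs (fun _ => one_pos) hcc (B := B) (fun _ _ => rfl) hΨB hTΦ
  simp only [one_pow, mul_one] at h
  set X := Real.sqrt (∑ z ∈ s ∩ B, fnorm τ ((Φ : Site d → 𝔸) z) ^ 2) with hX
  set Y := Real.sqrt (formE τ s Ψ Ψ) with hY
  have hS0 : 0 ≤ ∑ z ∈ s ∩ B, fnorm τ ((Φ : Site d → 𝔸) z) ^ 2 := Finset.sum_nonneg fun z _ => sq_nonneg _
  have hX0 : 0 ≤ X := Real.sqrt_nonneg _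
  have hY0 : 0 ≤ Y := Real.sqrt_nonneg _
  have hXsq : X ^ 2 = ∑ z ∈ s ∩ B, fnorm τ ((Φ : Site d → 𝔸) z) ^ 2 := Real.sq_sqrt hS0
  have hYsq : Y ^ 2 = formE τ s Ψ Ψ := Real.sq_sqrt (formE_self_nonneg' hτp Ψ)
  -- `c₀ m_B X² ≤ c₀ Σ_{Ω₀∩B} m|Φ|² ≤ c₀ Σ_{Ω₀} m|Φ|² ≤ X·Y`
  have hsub : mB * ∑ z ∈ s ∩ B, fnorm τ ((Φ : Site d → 𝔸) z) ^ 2 ≤ ∑ z ∈ s, m z * fnorm τ ((Φ : Site d → 𝔸) z) ^ 2 := by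
    rw [Finset.mul_sum]
    calc ∑ z ∈ s ∩ B, mB * fnorm τ ((Φ : Site d → 𝔸) z) ^ 2 ≤ ∑ z ∈ s ∩ B, m z * fnorm τ ((Φ : Site d → 𝔸) z) ^ 2 :=
          Finset.sum_le_sum fun z hz => mul_le_mul_of_nonneg_right (hmB' z (Finset.mem_inter.1 hz).2) (sq_nonneg _)
      _ ≤ ∑ z ∈ s, m z * fnorm τ ((Φ : Site d → 𝔸) z) ^ 2 :=
          Finset.sum_le_sum_of_subset_of_nonneg Finset.inter_subset_left fun z hz _ => mul_nonneg (hm0 z hz) (sq_nonneg _)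
  have hmain : c₀ * mB * X ^ 2 ≤ X * Y := by
    rw [hXsq, mul_assoc]
    exact (mul_le_mul_of_nonneg_left hsub hc₀.le).trans h
  -- divide
  have hcm : 0 < c₀ * mB := mul_pos hc₀ hmB
  have hXle : c₀ * mB * X ≤ Y := by
    by_cases hX0' : X = 0
    · rw [hX0', mul_zero]; exact hY0
    · have hXpos : 0 < X := lt_of_le_of_ne hX0 (Ne.symm hX0')
      nlinarith
  rw [← hXsq, ← hYsq, le_div_iff₀ (pow_pos hcm 2)]
  calc X ^ 2 * (c₀ * mB) ^ 2 = (c₀ * mB * X) ^ 2 := by ring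
    _ ≤ Y ^ 2 := pow_le_pow_left₀ (by positivity) hXle 2

/-- ★★★ **SECOND READING (S. Agmon's positive-weight bound).**  Plain weighted coercivity (`c₀ > 0`, `m ≥ 0` on `Ω₀`) AND the conjugated coercivity for a weight
`ω > 0` with `ω = 1` on `B`; `m ≥ m_B > 0` on `B`, `m ≥ m_A > 0` and `ω ≥ W > 0` on `A`; `TΦ = Ψ`, `Ψ = 0` off `B`.  THEN
`Σ_{z∈Ω₀∩A}|Φ(z)|²_τ ≤ ‖Ψ‖²_τ ∕ (c₀²·m_A·m_B·W²)` — print's (3.46a) `‖1_A G′ 1_B‖ ≤ B₀(Lʲη)(Lʲ′η)e^{−δ₀d}` with `B₀ = 1∕c₀` at the level masses `m = (Lʲη)⁻²`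
and `W = e^{δ₀d}`, the constants being EXACTLY the displayed ones (no `|Ω₀|`, no window).  PROOF: the Agmon reading gives `c₀m_AW²‖1_AΦ‖² ≤ c₀Σ mω²|Φ|² ≤
‖1_BΦ‖‖Ψ‖`, and the first reading `‖1_BΦ‖ ≤ ‖Ψ‖∕(c₀m_B)`.
[cite: Balaban1985BackgroundPropagators, (3.46) p.398, Thm 3.1 p.397; Agmon1982, Thm 1.5 p.19] -/
theorem sq_sum_le_of_conj_coercive (hτp : ∀ a : 𝔸, a ≠ 0 → 0 < (τ (star a * a)).re) (hτs : ∀ a : 𝔸, τ (star a) = starRingEnd ℂ (τ a))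
    {c₀ mA mB W : ℝ} (hc₀ : 0 < c₀) (hmA : 0 < mA) (hmB : 0 < mB) (hW : 0 < W)
    {m ω : Site d → ℝ} (hm0 : ∀ z ∈ s, 0 ≤ m z) (hω : ∀ z, 0 < ω z)
    (hco : ∀ Φ : suppSub (𝔸 := 𝔸) s, c₀ * ∑ z ∈ s, m z * fnorm τ ((Φ : Site d → 𝔸) z) ^ 2 ≤ formE τ s Φ (T Φ))
    (hcc : ∀ Φ : suppSub (𝔸 := 𝔸) s, c₀ * ∑ z ∈ s, m z * fnorm τ ((Φ : Site d → 𝔸) z) ^ 2 ≤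
      formE τ s (scaleFn s ω Φ) (T (scaleFn s (fun z => (ω z)⁻¹) Φ)))
    {A B : Finset (Site d)} (hmA' : ∀ z ∈ A, mA ≤ m z) (hmB' : ∀ z ∈ B, mB ≤ m z) (hWA : ∀ z ∈ A, W ≤ ω z) (hωB : ∀ z ∈ B, ω z = 1)
    {Φ Ψ : suppSub (𝔸 := 𝔸) s} (hΨB : ∀ z, z ∉ B → (Ψ : Site d → 𝔸) z = 0) (hTΦ : T Φ = Ψ) :
    ∑ z ∈ s ∩ A, fnorm τ ((Φ : Site d → 𝔸) z) ^ 2 ≤ formE τ s Ψ Ψ / (c₀ ^ 2 * mA * mB * W ^ 2) := by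
  classical
  have hread := weighted_sq_sum_le_of_conj_coercive hτp hτs hω hcc (B := B) hωB hΨB hTΦ
  have hfirst := sq_sum_le_of_coercive hτp hτs hc₀ hmB hm0 hco (B := B) hmB' hΨB hTΦ
  set SA := ∑ z ∈ s ∩ A, fnorm τ ((Φ : Site d → 𝔸) z) ^ 2 with hSA
  set SB := ∑ z ∈ s ∩ B, fnorm τ ((Φ : Site d → 𝔸) z) ^ 2 with hSB
  set N := formE τ s Ψ Ψ with hN
  have hSB0 : 0 ≤ SB := Finset.sum_nonneg fun z _ => sq_nonneg _
  have hN0 : 0 ≤ N := formE_self_nonneg' hτp Ψ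
  have hcm : 0 < c₀ * mB := mul_pos hc₀ hmB
  -- `√SB ≤ √N ∕ (c₀ m_B)`
  have hXB : Real.sqrt SB ≤ Real.sqrt N / (c₀ * mB) := by
    rw [le_div_iff₀ hcm, ← Real.sqrt_sq hcm.le, ← Real.sqrt_mul hSB0]
    exact Real.sqrt_le_sqrt ((le_div_iff₀ (pow_pos hcm 2)).1 hfirst)
  -- `c₀ m_A W² SA ≤ c₀ Σ m ω² |Φ|²`
  have hsub : mA * W ^ 2 * SA ≤ ∑ z ∈ s, m z * ω z ^ 2 * fnorm τ ((Φ : Site d → 𝔸) z) ^ 2 := by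
    rw [hSA, Finset.mul_sum]
    calc ∑ z ∈ s ∩ A, mA * W ^ 2 * fnorm τ ((Φ : Site d → 𝔸) z) ^ 2
        ≤ ∑ z ∈ s ∩ A, m z * ω z ^ 2 * fnorm τ ((Φ : Site d → 𝔸) z) ^ 2 := by
          refine Finset.sum_le_sum fun z hz => mul_le_mul_of_nonneg_right ?_ (sq_nonneg _)
          have hzA := (Finset.mem_inter.1 hz).2
          exact mul_le_mul (hmA' z hzA) (pow_le_pow_left₀ hW.le (hWA z hzA) 2) (sq_nonneg _) (hmA.le.trans (hmA' z hzA))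
      _ ≤ ∑ z ∈ s, m z * ω z ^ 2 * fnorm τ ((Φ : Site d → 𝔸) z) ^ 2 :=
          Finset.sum_le_sum_of_subset_of_nonneg Finset.inter_subset_left fun z hz _ =>
            mul_nonneg (mul_nonneg (hm0 z hz) (sq_nonneg _)) (sq_nonneg _)
  have hmain : c₀ * (mA * W ^ 2 * SA) ≤ Real.sqrt N / (c₀ * mB) * Real.sqrt N :=
    ((mul_le_mul_of_nonneg_left hsub hc₀.le).trans hread).trans (mul_le_mul_of_nonneg_right hXB (Real.sqrt_nonneg _))
  rw [div_mul_eq_mul_div, ← sq, Real.sq_sqrt hN0] at hmain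
  have hden : 0 < c₀ ^ 2 * mA * mB * W ^ 2 := by positivity
  rw [le_div_iff₀ hden]
  have h2 := mul_le_mul_of_nonneg_left hmain hcm.le
  rw [mul_div_cancel₀ _ hcm.ne'] at h2
  calc SA * (c₀ ^ 2 * mA * mB * W ^ 2) = c₀ * mB * (c₀ * (mA * W ^ 2 * SA)) := by ring
    _ ≤ N := h2

end TwoReadings

/-! ## §4  The pointwise kernel edition and the assembly helper -/

section Pointwise

variable {T : suppSub (𝔸 := 𝔸) s →ₗ[ℝ] suppSub (𝔸 := 𝔸) s}

/-- ★★★ **THE POINTWISE KERNEL EDITION ((3.42) n = 0 SHAPE).**  Under the plain and the `ω`-conjugated weighted coercivities (`c₀ > 0`, `m ≥ 0` on `Ω₀`, `ω > 0`),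
every solution of `TΦ = δ_y w` with `y ∈ Ω₀`, `ω(y) = 1`, `0 < m_x`, `0 < m_y` satisfies `|Φ(x)|_τ ≤ |w|_τ ∕ (c₀·√(m_x·m_y)·ω(x))` — print's `B₀(Lʲη)(Lʲ′η)e^{−δ₀d(y,y′)}`
with `B₀ = 1∕c₀` at `m = (Lʲη)⁻²`, `ω = e^{δ₀d(·,y′)}`; constants EXACTLY the displayed ones.
[cite: Balaban1985BackgroundPropagators, (3.42) p.397, (3.46) p.398, Thm 3.1 p.397; Agmon1982, Thm 1.5 p.19] -/
theorem fnorm_apply_le_of_conj_coercive (hτp : ∀ a : 𝔸, a ≠ 0 → 0 < (τ (star a * a)).re) (hτs : ∀ a : 𝔸, τ (star a) = starRingEnd ℂ (τ a))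
    {c₀ : ℝ} (hc₀ : 0 < c₀) {m ω : Site d → ℝ} (hm0 : ∀ z ∈ s, 0 ≤ m z) (hω : ∀ z, 0 < ω z)
    (hco : ∀ Φ : suppSub (𝔸 := 𝔸) s, c₀ * ∑ z ∈ s, m z * fnorm τ ((Φ : Site d → 𝔸) z) ^ 2 ≤ formE τ s Φ (T Φ))
    (hcc : ∀ Φ : suppSub (𝔸 := 𝔸) s, c₀ * ∑ z ∈ s, m z * fnorm τ ((Φ : Site d → 𝔸) z) ^ 2 ≤
      formE τ s (scaleFn s ω Φ) (T (scaleFn s (fun z => (ω z)⁻¹) Φ)))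
    {Φ : suppSub (𝔸 := 𝔸) s} {y : Site d} (hy : y ∈ s) {w : 𝔸} (hTΦ : T Φ = restrictSite s (single y w)) (hωy : ω y = 1)
    {x : Site d} (hmx : 0 < m x) (hmy : 0 < m y) :
    fnorm τ ((Φ : Site d → 𝔸) x) ≤ fnorm τ w / (c₀ * Real.sqrt (m x * m y) * ω x) := by
  classical
  have hden : 0 < c₀ * Real.sqrt (m x * m y) * ω x := by
    have := Real.sqrt_pos.2 (mul_pos hmx hmy); have := hω x; positivity
  by_cases hx : x ∈ s
  · have hΨB : ∀ z, z ∉ ({y} : Finset (Site d)) → (restrictSite s (single y w) : Site d → 𝔸) z = 0 := by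
      intro z hz
      rw [Finset.mem_singleton] at hz
      rw [restrictSite_single_coe hy, single_apply_of_ne hz]
    have h := sq_sum_le_of_conj_coercive hτp hτs hc₀ hmx hmy (hω x) hm0 hω hco hcc (A := {x}) (B := {y})
      (fun z hz => by rw [Finset.mem_singleton] at hz; rw [hz]) (fun z hz => by rw [Finset.mem_singleton] at hz; rw [hz])
      (fun z hz => by rw [Finset.mem_singleton] at hz; rw [hz]) (fun z hz => by rw [Finset.mem_singleton] at hz; rw [hz, hωy]) hΨB hTΦ
    rw [Finset.inter_singleton_of_mem hx, Finset.sum_singleton, formE_single_self hτp hy] at h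
    have hsq : fnorm τ ((Φ : Site d → 𝔸) x) ^ 2 ≤ (fnorm τ w / (c₀ * Real.sqrt (m x * m y) * ω x)) ^ 2 := by
      rw [div_pow]
      convert h using 2
      rw [mul_pow, mul_pow, Real.sq_sqrt (mul_pos hmx hmy).le]; ring
    have hr := Real.sqrt_le_sqrt hsq
    rwa [Real.sqrt_sq (fnorm_nonneg τ _), Real.sqrt_sq (div_nonneg (fnorm_nonneg τ w) hden.le)] at hr
  · rw [Φ.2 x hx, fnorm_zero]
    exact div_nonneg (fnorm_nonneg τ w) hden.le

/-- ★★ **THE SAME, FOR THE INVERSE AS A MAP**: with `G` a right inverse of `T` (`T(Gh) = h`, e.g. `G′(U₀) = GpZd` for `T = Ω₀Δ′_a(U₀)Ω₀`),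
`|(G(δ_y w))(x)|_τ ≤ |w|_τ ∕ (c₀·√(m_x·m_y)·ω(x))`. [cite: Balaban1985BackgroundPropagators, (3.42) p.397, (3.46) p.398, Thm 3.1 p.397] -/
theorem fnorm_inv_single_le_of_conj_coercive (hτp : ∀ a : 𝔸, a ≠ 0 → 0 < (τ (star a * a)).re) (hτs : ∀ a : 𝔸, τ (star a) = starRingEnd ℂ (τ a))
    {c₀ : ℝ} (hc₀ : 0 < c₀) {m ω : Site d → ℝ} (hm0 : ∀ z ∈ s, 0 ≤ m z) (hω : ∀ z, 0 < ω z)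
    (hco : ∀ Φ : suppSub (𝔸 := 𝔸) s, c₀ * ∑ z ∈ s, m z * fnorm τ ((Φ : Site d → 𝔸) z) ^ 2 ≤ formE τ s Φ (T Φ))
    (hcc : ∀ Φ : suppSub (𝔸 := 𝔸) s, c₀ * ∑ z ∈ s, m z * fnorm τ ((Φ : Site d → 𝔸) z) ^ 2 ≤
      formE τ s (scaleFn s ω Φ) (T (scaleFn s (fun z => (ω z)⁻¹) Φ)))
    (G : suppSub (𝔸 := 𝔸) s → suppSub (𝔸 := 𝔸) s) (hG : ∀ h, T (G h) = h)
    {y : Site d} (hy : y ∈ s) (w : 𝔸) (hωy : ω y = 1) {x : Site d} (hmx : 0 < m x) (hmy : 0 < m y) :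
    fnorm τ ((G (restrictSite s (single y w)) : Site d → 𝔸) x) ≤ fnorm τ w / (c₀ * Real.sqrt (m x * m y) * ω x) :=
  fnorm_apply_le_of_conj_coercive hτp hτs hc₀ hm0 hω hco hcc hy (hG _) hωy hmx hmy

/-- **ASSEMBLY HELPER**: a plain weighted coercivity `c₀Σ_z m_z|Φ z|² ≤ ⟨Φ, TΦ⟩` and a CONJUGATION DEFECT bound `⟨Φ, TΦ⟩ − θ·c₀Σ_z m_z|Φ z|² ≤ ⟨ωΦ, T(ω⁻¹Φ)⟩`
(the output shape of `B9Eq324ConjugatedFormZd`) give the conjugated coercivity with the constant `(1 − θ)c₀`.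
[cite: Balaban1985BackgroundPropagators, Thm 3.1 p.397, (3.46) p.398; Agmon1982, Thm 1.5 p.19] -/
theorem conj_coercive_of_defect {c₀ θ : ℝ} {m ω : Site d → ℝ}
    (hco : ∀ Φ : suppSub (𝔸 := 𝔸) s, c₀ * ∑ z ∈ s, m z * fnorm τ ((Φ : Site d → 𝔸) z) ^ 2 ≤ formE τ s Φ (T Φ))
    (hdef : ∀ Φ : suppSub (𝔸 := 𝔸) s, formE τ s Φ (T Φ) - θ * (c₀ * ∑ z ∈ s, m z * fnorm τ ((Φ : Site d → 𝔸) z) ^ 2) ≤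
      formE τ s (scaleFn s ω Φ) (T (scaleFn s (fun z => (ω z)⁻¹) Φ))) (Φ : suppSub (𝔸 := 𝔸) s) :
    (1 - θ) * c₀ * ∑ z ∈ s, m z * fnorm τ ((Φ : Site d → 𝔸) z) ^ 2 ≤ formE τ s (scaleFn s ω Φ) (T (scaleFn s (fun z => (ω z)⁻¹) Φ)) := by
  have h1 := hco Φ
  have h2 := hdef Φ
  nlinarith [h1, h2]

end Pointwise

end Literature.MathematicalPhysics.QuantumFieldTheory.Balaban1983to89.B9Eq346AgmonReadingZd

end
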